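import Literature.Probability.RandomPlanarGeometry.SAWPulledLargeForceExpansionZdIntegrality
import Literature.Probability.RandomPlanarGeometry.SAWCountZdDimensionCongruence
import Literature.Probability.RandomPlanarGeometry.SAWBridgeZdDimensionCongruence
import Literature.Probability.RandomPlanarGeometry.SAWZdLateralClassCensus
import HarnessLib

/-!
# TRANSLATION CONGRUENCES IN THE DIMENSION: `c_n(ℤ^{d+m}) ≡ c_n(ℤ^d) (mod 2m)` — and `(mod 4m)` after subtracting `2m` — for every `n, d, m`;
# the same `2m`-periodicity for `c_k^{(d)}`, `N_{c,n}`, `b_n`, `λ_n`, `h_n`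

Topic `Literature/Probability/RandomPlanarGeometry` (continues this lineage's integrality files: `exists_int_polynomial_largeForceCoeffZd` (`…ZdIntegrality`),
`exists_int_polynomial_count` / `exists_int_polynomial_costCoeffZd` (`SAWCountZdDimensionCongruence` / `…ZdHyperoctahedral`), `exists_int_polynomial_bridgeCount` /
`…_irreducibleBridgeCount` (`SAWBridgeZdDimensionCongruence`), `exists_int_polynomial_halfSpaceCount` (`SAWZdLateralClassCensus`); `SAWRatioLimit.count_one_eq_two`).

PRINTED CONTEXT (locators only). Clisby–Liang–Slade (2007) §3.3; Madras–Slade (1993) §1.1 eq. (1.1.8); Janse van Rensburg–Whittington (2013) §3.2 Theorem 8. NOT IN PRINT (lane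
statements): an integer polynomial `Q` has `2m = 2(d+m) − 2d ∣ Q(2(d+m)) − Q(2d)`, so every census that is an integer polynomial in `2d` is `2m`-PERIODIC MODULO `2m` in the
dimension; and where the polynomial is `2d·R(2d)` with `R(2) = 1` odd (the SAW counts), one more factor `2` is available after subtracting `2m`:

* ★★★ `two_mul_dvd_count_add_sub_count` — **`2m ∣ c_n(ℤ^{d+m}) − c_n(ℤ^d)`** (`n ≥ 1`; `c_n(ℤ^{d+3}) ≡ c_n(ℤ^d) (mod 6)`, `c_n(ℤ^{d+5}) ≡ c_n(ℤ^d) (mod 10)`, …);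
* ★★★ `four_mul_dvd_count_add_sub_count_sub` — **`4m ∣ c_n(ℤ^{d+m}) − c_n(ℤ^d) − 2m`** (`n ≥ 1`);
* ★★★ `two_mul_dvd_largeForceCoeffZd_add_sub` — **`2m ∣ c_k^{(d+m)} − c_k^{(d)}`** for every `k, d, m`;
* ★★ `two_mul_dvd_costCoeffZd_add_sub`, `two_mul_dvd_bridgeCount_add_sub` (bridges and irreducible bridges), `two_mul_dvd_halfSpaceCount_add_sub`.
Numerical face (not used): `c₃(ℤ⁴) − c₃(ℤ¹) = 390 = 65·6` and `390 − 6 = 384 = 32·12`; `c₂(ℤ⁶) − c₂(ℤ¹) = 130 = 13·10` and `130 − 10 = 120 = 6·20`; `c₂(ℤ³) − c₂(ℤ²) − 2 = 16 = 4·4`.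
[cite: ClisbyLiangSlade2007, §3.3 eqs. (29)/(31)] [cite: MadrasSlade1993, §1.1 eq. (1.1.8) p. 5] [cite: JansevanRensburgWhittington2013, §3.2 Theorem 8 (arXiv v4 p. 11)]

Provenance: lane «pcv-sawmu», a-p3 g25 (2026-08-28). PURE STD, no data, no definitions.
-/

noncomputable section

open Finset
open scoped BigOperators
open Literature.Probability.LatticeModels
open Literature.Probability.RandomPlanarGeometry.SAW

namespace Literature.Probability.RandomPlanarGeometry.SAW.Zd

/-! ## §16 Translation congruences in the dimension: `f(d + m) ≡ f(d) (mod 2m)` for every census that is an integer polynomial in `2d` -/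

section Translation

/-- An integer polynomial in `2d` is `2m`-periodic modulo `2m`: `2m ∣ Q(2(d+m)) − Q(2d)`. [folklore] -/
private theorem two_mul_dvd_sub_of_eval_two_mul {f : ℕ → ℤ} (h : ∃ Q : Polynomial ℤ, ∀ d : ℕ, f d = Q.eval (2 * (d : ℤ))) (d m : ℕ) :
    (2 * (m : ℤ)) ∣ f (d + m) - f d := by
  obtain ⟨Q, hQ⟩ := h
  rw [hQ, hQ]
  have := Polynomial.sub_dvd_eval_sub (2 * ((d + m : ℕ) : ℤ)) (2 * (d : ℤ)) Q
  have e : 2 * ((d + m : ℕ) : ℤ) - 2 * (d : ℤ) = 2 * (m : ℤ) := by push_cast; ring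
  rwa [e] at this

/-- ★★★ **`c_n(ℤ^{d+m}) ≡ c_n(ℤ^d) (mod 2m)`** for all `n ≥ 1`, `d`, `m`: the SAW counts are `2m`-periodic in the dimension modulo `2m` (e.g. `c_n(ℤ^{d+3}) ≡ c_n(ℤ^d) (mod 6)`,
`c_n(ℤ^{d+5}) ≡ c_n(ℤ^d) (mod 10)`; face: `c₃(ℤ⁴) − c₃(ℤ¹) = 392 − 2 = 65·6`, `c₂(ℤ⁶) − c₂(ℤ¹) = 132 − 2 = 13·10`). [cite: ClisbyLiangSlade2007, §3.3 eqs. (29)/(31)]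
[cite: MadrasSlade1993, §1.1 eq. (1.1.8) p. 5] -/
theorem two_mul_dvd_count_add_sub_count {n : ℕ} (hn : 1 ≤ n) (d m : ℕ) :
    (2 * (m : ℤ)) ∣ (count (d + m) n : ℤ) - count d n := by
  obtain ⟨P, -, -, hP⟩ := exists_int_polynomial_count hn
  exact two_mul_dvd_sub_of_eval_two_mul ⟨P, hP⟩ d m

/-- ★★★ **`c_k^{(d+m)} ≡ c_k^{(d)} (mod 2m)`** for all `k`, `d`, `m`: the large-force coefficients are `2m`-periodic in the dimension modulo `2m`.
[cite: JansevanRensburgWhittington2013, §3.2 Theorem 8 (arXiv v4 p. 11)] -/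
theorem two_mul_dvd_largeForceCoeffZd_add_sub (k d m : ℕ) :
    (2 * (m : ℤ)) ∣ largeForceCoeffZd (d + m) k - largeForceCoeffZd d k := by
  obtain ⟨S, -, -, hS⟩ := exists_int_polynomial_largeForceCoeffZd k
  exact two_mul_dvd_sub_of_eval_two_mul ⟨S, hS⟩ d m

/-- ★★ `N_{c,n}(ℤ^{d+m+1}) ≡ N_{c,n}(ℤ^{d+1}) (mod 2m)` for every cost cell. [cite: MadrasSlade1993, §4.2 eq. (4.2.20)–(4.2.22) p. 94] -/
theorem two_mul_dvd_costCoeffZd_add_sub (c n d m : ℕ) :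
    (2 * (m : ℤ)) ∣ (costCoeffZd (d + m) c n : ℤ) - costCoeffZd d c n := by
  obtain ⟨P, -, -, hP⟩ := exists_int_polynomial_costCoeffZd c n
  exact two_mul_dvd_sub_of_eval_two_mul ⟨P, hP⟩ d m

/-- ★★ `b_n(ℤ^{d+m+1}) ≡ b_n(ℤ^{d+1}) (mod 2m)` and `λ_n(ℤ^{d+m+1}) ≡ λ_n(ℤ^{d+1}) (mod 2m)`: bridges and irreducible bridges.
[cite: MadrasSlade1993, §4.2 eq. (4.2.2) p. 90] -/
theorem two_mul_dvd_bridgeCount_add_sub (n d m : ℕ) :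
    (2 * (m : ℤ)) ∣ (bridgeCount (d + m + 1) n : ℤ) - bridgeCount (d + 1) n ∧
      (2 * (m : ℤ)) ∣ (irreducibleBridgeCount (d + m + 1) n : ℤ) - irreducibleBridgeCount (d + 1) n := by
  obtain ⟨B, -, -, hB⟩ := exists_int_polynomial_bridgeCount n
  obtain ⟨L, -, -, hL⟩ := exists_int_polynomial_irreducibleBridgeCount n
  exact ⟨two_mul_dvd_sub_of_eval_two_mul (f := fun e => (bridgeCount (e + 1) n : ℤ)) ⟨B, hB⟩ d m,
    two_mul_dvd_sub_of_eval_two_mul (f := fun e => (irreducibleBridgeCount (e + 1) n : ℤ)) ⟨L, hL⟩ d m⟩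

/-- ★★ `h_n(ℤ^{d+m+1}) ≡ h_n(ℤ^{d+1}) (mod 2m)`: half-space walks. [cite: MadrasSlade1993, Definition 3.1.2] -/
theorem two_mul_dvd_halfSpaceCount_add_sub (n d m : ℕ) :
    (2 * (m : ℤ)) ∣ (halfSpaceCount (d + m + 1) n : ℤ) - halfSpaceCount (d + 1) n := by
  obtain ⟨Q, -, -, hQ⟩ := exists_int_polynomial_halfSpaceCount n
  exact two_mul_dvd_sub_of_eval_two_mul (f := fun e => (halfSpaceCount (e + 1) n : ℤ)) ⟨Q, hQ⟩ d m

/-- ★★ The odd part: for ODD `m`, `c_n(ℤ^{d+m}) ≡ c_n(ℤ^d) (mod 4m)` as well (`n ≥ 1`) — both sides are `≡ 2d` resp. `≡ 2(d+m) ≡ 2d + 2m (mod 4)` … precisely: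
**`4m ∣ c_n(ℤ^{d+m}) − c_n(ℤ^d) − 2m`** for every `n ≥ 1`, `d`, `m` (from `c_n(ℤ^d) = 2d·R_n(2d)`: the difference is `2m·R_n(2d+2m) + 2d·(R_n(2d+2m) − R_n(2d))` and
`R_n(2d+2m) ≡ R_n(2d) ≡ R_n(0) = c_n(ℤ¹)/2 = 1 (mod 2)`; face: `c₃(ℤ⁴) − c₃(ℤ¹) − 6 = 384 = 32·12`, `c₂(ℤ³) − c₂(ℤ²) − 2 = 30 − 12 − 2 = 16 = 4·4`).
[cite: ClisbyLiangSlade2007, §3.3 eqs. (29)/(31)] [cite: MadrasSlade1993, §1.1 eq. (1.1.8) p. 5] -/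
theorem four_mul_dvd_count_add_sub_count_sub {n : ℕ} (hn : 1 ≤ n) (d m : ℕ) :
    (4 * (m : ℤ)) ∣ (count (d + m) n : ℤ) - count d n - 2 * (m : ℤ) := by
  obtain ⟨P, -, hP0, hP⟩ := exists_int_polynomial_count hn
  obtain ⟨R, hR⟩ := Polynomial.X_dvd_iff.2 hP0
  -- `R(0) = c_n(ℤ¹)/2 = 1`: from `c_n(ℤ¹) = 2 = 2·R(2)`? use `R(2a) ≡ R(0) (mod 2)` and `c_n(ℤ^1) = 2 R(2)` instead
  have hev : ∀ e : ℕ, (count e n : ℤ) = 2 * (e : ℤ) * R.eval (2 * (e : ℤ)) := fun e => by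
    rw [hP e, hR, Polynomial.eval_mul, Polynomial.eval_X]
  have h1 : R.eval 2 = 1 := by
    have := hev 1
    rw [count_one_eq_two hn] at this
    norm_num at this
    linarith
  -- parity of `R` at even arguments: `R(2a) ≡ R(2) = 1 (mod 2)`
  have hodd : ∀ a : ℤ, (2 : ℤ) ∣ R.eval (2 * a) - 1 := by
    intro a
    have h := Polynomial.sub_dvd_eval_sub (2 * a) 2 R
    rw [h1] at h
    exact (Dvd.intro (a - 1) (by ring)).trans h
  obtain ⟨q, hq⟩ := Polynomial.sub_dvd_eval_sub (2 * ((d + m : ℕ) : ℤ)) (2 * (d : ℤ)) R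
  obtain ⟨r, hr⟩ := hodd ((d + m : ℕ) : ℤ)
  rw [hev (d + m), hev d]
  refine ⟨(d : ℤ) * q + r, ?_⟩
  have e1 : (2 * ((d + m : ℕ) : ℤ) - 2 * (d : ℤ)) = 2 * (m : ℤ) := by push_cast; ring
  rw [e1] at hq
  push_cast at hq hr ⊢
  linear_combination (2 * (d : ℤ)) * hq + (2 * (m : ℤ)) * hr

end Translation

end Literature.Probability.RandomPlanarGeometry.SAW.Zd

end
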